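import Summits.AnomalousDissipation.AnomalousDissipation.Theorems.SolenoidalFractalHomogenisationLagrangianStepFrameConjugacyFS
import Summits.AnomalousDissipation.AnomalousDissipation.Theorems.SolenoidalFractalHomogenisationLagrangianStepVmodFrameDefsJA
import Summits.AnomalousDissipation.AnomalousDissipation.Theorems.SolenoidalFractalHomogenisationLagrangianStepZ7GlueCompose
import HarnessLib

/-!
# K1L_D (stmt-AnomalousDissipation-27980), (ℓ3-A) road A, v3A head inputs: RESCALING of the frame predicates in `(θ, nC)`, the UNPACKED conjugacy
# provider (explicit clamped frame, so that the `J`-instance can ride along), and the generic «key ⇒ piece bound» step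
(helper, `--supports 27980 --as helper`; prover lead-k1l-onelevel-p1 g8; RULINGS D28-23 (final head `vmod_EXK_of_VRH0FJA`), D28-25 (2b); FINDING F-lead-g8-1.)

Three ingredients of the FINAL HEAD `Z7Glue.vmod_EXK_of_VRH0FJA` (next file), none of which changes a text or introduces a definition:
* §1 **rescaling** (F-lead-g8-1): `IsFrameModulation θ Tw nC G` depends on `nC` only through the product `θ·nC` (`grad_le`), and
  `IsFrameRegular` / `IsFrameRegular6` only through `θ·nC^{|l|}` (`derivBound`); hence `(θ, nC) ↦ (θ', nC')` with `θ ≤ θ'`,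
  `θ·nC^l ≤ θ'·nC'^l` is free (`isFrameModulation_rescale`, `isFrameRegular_rescale`, `isFrameRegular6_rescale`).  The head uses it with
  `nC' = λ·nC ≤ ϱ₁·N m` (λ := min 1 (ϱ₁/ϱ_*)), `θ' = θ/λ⁶`, which is what makes the ν-token `nC ≤ ϱ₁ (ν/K)^{4/3} n` of the v3A texts follow from
  the `PieceTK` binder `hKr` ALONE (`N m ≤ (ν/K)^{4/3} N(m+1)`), ϱ₁ being the clause provider's constant.
* §2 **the generic step (b)+(c) of `eulerian_pieceW_lam0*`**: from the clause's conclusion AT THE FRAME DATA (`hkey`, any road F/FS/FJ/FJA/FJB) and the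
  conjugacy identities, the loss-currency bound for the Eulerian pair on the piece (`lossBound_of_frameKey`).
* §3 **the UNPACKED conjugacy provider** `frameConjugacy_unpacked_of_modulation`: `frameConjugacyAtFS_of_modulation` (p725028) with the conclusion NOT
  packed into `FrameConjugacyAtFS` (whose `∃ G` hides the frame): the two `IsDistortedPropagatorS` facts are stated for the EXPLICIT clamped curve
  `τ ↦ frameG E m (jR + clamp(τ)/a) jR`, so that the head can attach `IsFrameRegular/6 … Gclamp Jclamp` (`…FrameInstanceRegularity`) to the same `G`.
No sorry, no definition, no named fact.  NOT a proof of any block, of K1L_D or of AD; rung F-D1.A0.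
-/

set_option linter.dupNamespace false

noncomputable section

namespace Summit.AnomalousDissipation.AnomalousDissipation.Theorems.SolenoidalFractalHomogenisation.LagrangianStep.FrameInst

open Set Function Filter MeasureTheory Topology
open scoped NNReal ENNReal InnerProductSpace
open Literature.Analysis Literature.Analysis.FunctionSpaces Literature.Analysis.FunctionSpaces.Torus
open Literature.Analysis.FluidPDE Literature.Analysis.FluidPDE.LatticeShear
open Literature.Analysis.FluidPDE.LatticeShear (LagrangianLatticeCarrier LatticeWord)
open Summit.AnomalousDissipation.AnomalousDissipation.Theorems.SolenoidalFractalHomogenisation.LagrangianStep.CellClauseMod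
open Summit.AnomalousDissipation.AnomalousDissipation.Theorems.SolenoidalFractalHomogenisation.LagrangianStep.VmodDist
open Summit.AnomalousDissipation.AnomalousDissipation.Theorems.SolenoidalFractalHomogenisation.LagrangianStep.FrameConj
open Summit.AnomalousDissipation.AnomalousDissipation.Theorems.SolenoidalFractalHomogenisation.LagrangianStep.Z7Glue

variable {k : ℕ}

/-! ## §1 Rescaling `(θ, nC)` -/

/-- **`IsFrameModulation` only sees `θ` and the product `θ·nC`**: `θ ≤ θ'`, `θ·nC ≤ θ'·nC'` transport the datum. -/
theorem isFrameModulation_rescale {θ θ' Tw nC nC' : ℝ} {G : ℝ → UnitAddTorus (Fin 3) → Matrix (Fin 3) (Fin 3) ℝ}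
    (h : IsFrameModulation θ Tw nC G) (hθ : θ ≤ θ') (hprod : θ * nC ≤ θ' * nC') (hTw : 0 < Tw) : IsFrameModulation θ' Tw nC' G where
  toIsModulation :=
    { init := h.init
      near_one := fun t ht y i j => (h.near_one t ht y i j).trans hθ
      det_one := h.det_one
      piola := h.piola
      smooth := h.smooth
      grad_le := fun t ht y i j c => (h.grad_le t ht y i j c).trans hprod
      lipschitz := h.lipschitz
      tvar := by
        obtain ⟨βr, hβ0, hβi, hβle, hβ⟩ := h.tvar
        exact ⟨βr, hβ0, hβi, hβle.trans hθ, hβ⟩ }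
  clamped := h.clamped
  rate := fun y i j t₁ ht₁ t₂ ht₂ => (h.rate y i j t₁ ht₁ t₂ ht₂).trans
    (mul_le_mul_of_nonneg_right (div_le_div_of_nonneg_right hθ hTw.le) (abs_nonneg _))
  holonomic := h.holonomic

/-- **`IsFrameRegular` only sees `θ·nC^{|l|}`** (`|l| = 1, 2`). -/
theorem isFrameRegular_rescale {θ θ' Tw nC nC' : ℝ} {G J : ℝ → UnitAddTorus (Fin 3) → Matrix (Fin 3) (Fin 3) ℝ}
    (h : IsFrameRegular θ Tw nC G J) (hpow : ∀ l : ℕ, 1 ≤ l → l ≤ 6 → θ * nC ^ l ≤ θ' * nC' ^ l) : IsFrameRegular θ' Tw nC' G J where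
  mul_eq_one := h.mul_eq_one
  smooth := h.smooth
  jointCont := h.jointCont
  lipschitz := h.lipschitz
  aeDeriv := h.aeDeriv
  jointContG := h.jointContG
  aeDerivG := h.aeDerivG
  derivBound := fun t ht y i j l hl1 hl2 => by
    obtain ⟨hG, hJ⟩ := h.derivBound t ht y i j l hl1 hl2
    have hp := hpow l.length hl1 (hl2.trans (by norm_num))
    exact ⟨hG.trans hp, hJ.trans (by linarith)⟩

/-- **`IsFrameRegular6` only sees `θ·nC^{|l|}`** (`1 ≤ |l| ≤ 6`). -/
theorem isFrameRegular6_rescale {θ θ' Tw nC nC' : ℝ} {G J : ℝ → UnitAddTorus (Fin 3) → Matrix (Fin 3) (Fin 3) ℝ}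
    (h : IsFrameRegular6 θ Tw nC G J) (hpow : ∀ l : ℕ, 1 ≤ l → l ≤ 6 → θ * nC ^ l ≤ θ' * nC' ^ l) : IsFrameRegular6 θ' Tw nC' G J where
  derivBound6 := fun t ht y i j l hl1 hl6 => by
    obtain ⟨hG, hJ⟩ := h.derivBound6 t ht y i j l hl1 hl6
    have hp := hpow l.length hl1 hl6
    exact ⟨hG.trans hp, hJ.trans (by linarith)⟩

/-- **The rescaling of the head**: for `0 < λ ≤ 1`, `0 ≤ θ`, `0 ≤ nC` and `1 ≤ l ≤ 6`, `θ·nC^l ≤ (θ/λ⁶)·(λ·nC)^l`. -/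
theorem rescale_pow_le {θ nC lam : ℝ} (hθ : 0 ≤ θ) (hnC : 0 ≤ nC) (hlam0 : 0 < lam) (hlam1 : lam ≤ 1) (l : ℕ) (hl : l ≤ 6) :
    θ * nC ^ l ≤ θ / lam ^ 6 * (lam * nC) ^ l := by
  rw [mul_pow, div_mul_eq_mul_div, mul_comm (lam ^ l), ← mul_assoc, mul_div_assoc]
  refine le_mul_of_one_le_right (mul_nonneg hθ (pow_nonneg hnC _)) ?_
  rw [one_le_div (pow_pos hlam0 6)]
  exact pow_le_pow_of_le_one hlam0.le hlam1 hl

/-! ## §2 From the clause AT THE FRAME DATA to the Eulerian pair on the piece -/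

/-- **Steps (b)+(c) of the Eulerian piece lemma, road-independent.**  If the clause's conclusion holds for the two distorted members `Ut, Tt`
on the cell window (`hkey`, error `η`), the conjugacy identities read the Eulerian pair `(Um1, Um)` on divergence-free data (`hconj`, losses
preserved `hlossF`, `hlossA`), and `η ≤ η̄`, `0 ≤ η̄`, then the Eulerian pair obeys the loss-currency bound with `η̄` for ALL data
(`lossBound_of_divFree_propagator`). -/
theorem lossBound_of_frameKey {T₀ : ℝ} {bm bm1 : ℝ → VF} {𝔸m 𝔸m1 : Torus.Visc4 (Fin 3)} {Um Um1 Ut Tt : ℝ → ℝ → (V2 →L[ℝ] V2)}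
    (hUm : Torus.IsPropagator T₀ bm 𝔸m Um) (hUm1 : Torus.IsPropagator T₀ bm1 𝔸m1 Um1) (s t Tw : ℝ) {η ηbar : ℝ}
    (hηbar0 : 0 ≤ ηbar) (hηle : η ≤ ηbar) {ι ι' : V2 → V2}
    (hconj : ∀ x y : V2, Torus.IsWeaklyDivFree (⇑x : VF) → Torus.IsWeaklyDivFree (⇑y : VF) →
      ⟪Um1 s t x - Um s t x, y⟫_ℝ = ⟪Ut 0 Tw (ι x) - Tt 0 Tw (ι x), ι' y⟫_ℝ)
    (hlossF : ∀ x : V2, Torus.IsWeaklyDivFree (⇑x : VF) → lossFwd (Tt 0 Tw) (ι x) = lossFwd (Um s t) x)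
    (hlossA : ∀ y : V2, Torus.IsWeaklyDivFree (⇑y : VF) → lossAdj (Tt 0 Tw) (ι' y) = lossAdj (Um s t) y)
    (hkey : ∀ x ζ : V2, |⟪Ut 0 Tw x - Tt 0 Tw x, ζ⟫_ℝ| ≤ η * Real.sqrt (lossFwd (Tt 0 Tw) x) * Real.sqrt (lossAdj (Tt 0 Tw) ζ)) :
    ∀ x y : V2, |⟪Um1 s t x - Um s t x, y⟫_ℝ| ≤ ηbar * Real.sqrt (lossFwd (Um s t) x) * Real.sqrt (lossAdj (Um s t) y) := by
  have hdiv : ∀ x y : V2, Torus.IsWeaklyDivFree (⇑x : VF) → Torus.IsWeaklyDivFree (⇑y : VF) →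
      |⟪Um1 s t x - Um s t x, y⟫_ℝ| ≤ ηbar * Real.sqrt (lossFwd (Um s t) x) * Real.sqrt (lossAdj (Um s t) y) := by
    intro x y hx hy
    rw [hconj x y hx hy, ← hlossF x hx, ← hlossA y hy]
    refine (hkey (ι x) (ι' y)).trans ?_
    exact mul_le_mul (mul_le_mul_of_nonneg_right hηle (Real.sqrt_nonneg _)) le_rfl (Real.sqrt_nonneg _)
      (mul_nonneg hηbar0 (Real.sqrt_nonneg _))
  exact lossBound_of_divFree_propagator hUm hUm1 s t hηbar0 hdiv

/-! ## §3 The unpacked conjugacy provider (explicit clamped frame) -/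

/-- **Conjugacy data on a closed piece, UNPACKED** — `frameConjugacyAtFS_of_modulation` with the two `IsDistortedPropagatorS` members and the
readings `ι = id`, `ι' = frameRead` stated for the EXPLICIT clamped curve (no `∃ G`); the frame-modulation datum is not an input here (the head
supplies it — rescaled — directly to the clause). -/
theorem frameConjugacy_unpacked_of_modulation (E : LagrangianLatticeCarrier k) (hL : E.LPermissible) (hR : E.LevelRegular) {W : LatticeWord k}
    {M : ℝ} {hM : 0 < M} (hdes : E.design = W.stretch M hM) (Φ : ℝ → Torus.Visc4 (Fin 3) → Torus.Visc4 (Fin 3))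
    (m j : ℕ) (S : Torus.Visc4 (Fin 3)) {t : ℝ}
    (hj0 : 0 ≤ (j : ℝ) * E.refresh (m + 1)) (hjt : (j : ℝ) * E.refresh (m + 1) < t)
    (htR : t ≤ (j : ℝ) * E.refresh (m + 1) + E.refresh (m + 1)) (ht1 : t ≤ 1) (hν : 0 < E.cellVisc (m + 1))
    {Um Um1 : ℝ → ℝ → (V2 →L[ℝ] V2)}
    (hU1 : Torus.IsPropagator 1 (E.partialSum (m + 1)) (E.kbar (m + 1) • S) Um1)
    (hU : Torus.IsPropagator 1 (E.partialSum m) (E.kbar m • renormStep (Φ (E.cellVisc (m + 1))) (E.gain / E.cellVisc (m + 1) ^ 2) S) Um)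
    {lo₁ hi₁ lo₀ hi₀ : ℝ} (h𝔸1 : Torus.NearIso (E.kbar (m + 1) • S) lo₁ hi₁) (hlo₁ : 0 < lo₁)
    (h𝔸0 : Torus.NearIso (E.kbar m • renormStep (Φ (E.cellVisc (m + 1))) (E.gain / E.cellVisc (m + 1) ^ 2) S) lo₀ hi₀) (hlo₀ : 0 < lo₀) :
    ∃ Ut Tt : ℝ → ℝ → (V2 →L[ℝ] V2),
      IsDistortedPropagatorS (E.a (m + 1) * (t - (j : ℝ) * E.refresh (m + 1)))
        ((1 / (E.N (m + 1) : ℝ) ^ 2) • (E.cellVisc (m + 1) • S))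
        (cellField W M hM (E.cellVisc (m + 1)) hν (E.N (m + 1)))
        (fun τ y => frameG E m ((j : ℝ) * E.refresh (m + 1)
          + max 0 (min τ (E.a (m + 1) * (t - (j : ℝ) * E.refresh (m + 1)))) / E.a (m + 1)) ((j : ℝ) * E.refresh (m + 1)) y) Ut ∧
      IsDistortedPropagatorS (E.a (m + 1) * (t - (j : ℝ) * E.refresh (m + 1)))
        ((1 / (E.N (m + 1) : ℝ) ^ 2) • (E.cellVisc (m + 1) • S +
          (E.gain / E.cellVisc (m + 1)) • Φ (E.cellVisc (m + 1)) ((1 / E.cellVisc (m + 1)) • (E.cellVisc (m + 1) • S)))) (fun _ _ => 0)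
        (fun τ y => frameG E m ((j : ℝ) * E.refresh (m + 1)
          + max 0 (min τ (E.a (m + 1) * (t - (j : ℝ) * E.refresh (m + 1)))) / E.a (m + 1)) ((j : ℝ) * E.refresh (m + 1)) y) Tt ∧
      ∃ ι ι' : V2 → V2,
        (∀ x y : V2, Torus.IsWeaklyDivFree (⇑x : VF) → Torus.IsWeaklyDivFree (⇑y : VF) →
          ⟪Um1 ((j : ℝ) * E.refresh (m + 1)) t x - Um ((j : ℝ) * E.refresh (m + 1)) t x, y⟫_ℝ
            = ⟪Ut 0 (E.a (m + 1) * (t - (j : ℝ) * E.refresh (m + 1))) (ι x)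
                - Tt 0 (E.a (m + 1) * (t - (j : ℝ) * E.refresh (m + 1))) (ι x), ι' y⟫_ℝ) ∧
        (∀ x : V2, Torus.IsWeaklyDivFree (⇑x : VF) →
          lossFwd (Tt 0 (E.a (m + 1) * (t - (j : ℝ) * E.refresh (m + 1)))) (ι x) = lossFwd (Um ((j : ℝ) * E.refresh (m + 1)) t) x) ∧
        (∀ y : V2, Torus.IsWeaklyDivFree (⇑y : VF) →
          lossAdj (Tt 0 (E.a (m + 1) * (t - (j : ℝ) * E.refresh (m + 1)))) (ι' y) = lossAdj (Um ((j : ℝ) * E.refresh (m + 1)) t) y) := by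
  set s : ℝ := (j : ℝ) * E.refresh (m + 1) with hs
  have hL1 : ∀ (σ : ℝ) (u : V2),
      Torus.IsWeaklyDivFree (Torus.distort (frameG E m (s + σ / E.a (m + 1)) s) (⇑(frameRead E hR m s σ u) : VF)) ↔
        Torus.IsWeaklyDivFree (⇑u : VF) :=
    fun σ u => isWeaklyDivFree_distort_frameRead_iff' E hR m _ σ u
  have hUt := isDistortedPropagatorS_conjProp_clamped E hR m hj0 hjt ht1 hU1 hL1
    (𝔸c := (1 / (E.N (m + 1) : ℝ) ^ 2) • (E.cellVisc (m + 1) • S))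
    (bc := cellField W M hM (E.cellVisc (m + 1)) hν (E.N (m + 1)))
    (hT1_true E hL hR hdes m j hjt.le htR S hν) (hErepr_partialSum E hR (m + 1) h𝔸1 hlo₁ hU1 hj0 ht1)
    (exists_sol_true E hL hR hdes m j hjt.le htR S hν h𝔸1 hlo₁)
  have hTt := isDistortedPropagatorS_conjProp_clamped E hR m hj0 hjt ht1 hU hL1
    (𝔸c := (1 / (E.N (m + 1) : ℝ) ^ 2) • (E.cellVisc (m + 1) • S +
      (E.gain / E.cellVisc (m + 1)) • Φ (E.cellVisc (m + 1)) ((1 / E.cellVisc (m + 1)) • (E.cellVisc (m + 1) • S))))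
    (bc := fun (_ : ℝ) (_ : UnitAddTorus (Fin 3)) => (0 : EuclideanSpace ℝ (Fin 3)))
    (hT1_coarse E hL hR m j hjt.le htR Φ S) (hErepr_partialSum E hR m h𝔸0 hlo₀ hU hj0 ht1)
    (exists_sol_coarse E hL hR m j hjt.le htR Φ S h𝔸0 hlo₀)
  -- the endpoint readings of the clamped conjugate families
  have hTw : 0 ≤ E.a (m + 1) * (t - s) := mul_nonneg (E.a_pos (m + 1)).le (by linarith)
  have hc0 : max 0 (min 0 (E.a (m + 1) * (t - s))) = 0 := clamp_eq_self ⟨le_rfl, hTw⟩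
  have hcT : max 0 (min (E.a (m + 1) * (t - s)) (E.a (m + 1) * (t - s))) = E.a (m + 1) * (t - s) := clamp_eq_self ⟨hTw, le_rfl⟩
  have hU0 : ∀ x : V2, conjProp E hR m s Um1 (max 0 (min 0 (E.a (m + 1) * (t - s))))
      (max 0 (min (E.a (m + 1) * (t - s)) (E.a (m + 1) * (t - s)))) x = frameRead E hR m s (E.a (m + 1) * (t - s)) (Um1 s t x) := fun x => by
    simp only [hc0, hcT]
    exact conjProp_zero_apply E hR m s t Um1 x
  have hT0 : ∀ x : V2, conjProp E hR m s Um (max 0 (min 0 (E.a (m + 1) * (t - s))))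
      (max 0 (min (E.a (m + 1) * (t - s)) (E.a (m + 1) * (t - s)))) x = frameRead E hR m s (E.a (m + 1) * (t - s)) (Um s t x) := fun x => by
    simp only [hc0, hcT]
    exact conjProp_zero_apply E hR m s t Um x
  have hT0' : conjProp E hR m s Um (max 0 (min 0 (E.a (m + 1) * (t - s))))
      (max 0 (min (E.a (m + 1) * (t - s)) (E.a (m + 1) * (t - s)))) = (frameRead E hR m s (E.a (m + 1) * (t - s))).comp (Um s t) :=
    ContinuousLinearMap.ext fun x => by rw [hT0, ContinuousLinearMap.comp_apply]
  refine ⟨_, _, hUt, hTt, fun x => x, fun y => frameRead E hR m s (E.a (m + 1) * (t - s)) y, ?_, ?_, ?_⟩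
  · intro x y _ _
    rw [hU0, hT0, ← map_sub, inner_frameRead]
  · intro x _
    unfold lossFwd
    rw [hT0, norm_frameRead]
  · intro y _
    unfold lossAdj
    rw [hT0', ContinuousLinearMap.adjoint_comp, ContinuousLinearMap.comp_apply, adjoint_frameRead_apply, norm_frameRead]

end Summit.AnomalousDissipation.AnomalousDissipation.Theorems.SolenoidalFractalHomogenisation.LagrangianStep.FrameInst

end
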